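import Mathlib
import Summits.NavierStokesRegularity.NavierStokesRegularity.Theorems.TaoLadderRungTwoFlatCertificateGlueLohnerMeanValueOn
import HarnessLib

/-!
# Certificate glue on a shift set `𝕊`, XVIII-d: THE PER-ROW TAYLOR REMAINDER and the mean-value Lohner landing with a remainder vector AND
  per-row remainder factors (helper for items stmt-NavierStokesRegularity-22987 `FlatGapCertificatesV2` (crux K_A♭ of route TaoLadderRungTwoFlat)
  and stmt-24295 K_A₂(64); cell harvest/h2-tao-ladder, p1 g16; theory-1 NUM-T41m F-24 «β_c = b_c/b is load-bearing in the vector-E recursion: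
  33/98 rows β < 1e-3», NUM-T41p layout V «E1v_c = κI_c + dP_c + T_c + D_c + β_c·S_Q»)

S1 (`TaylorModel.stub_soundness`, via the public majorant toolkit `TaylorModelMajorant.IsMajorantSystem`) bounds the Taylor remainder of the
flow uniformly over the rows: `|Φ(y)(t) − TP_t(y)|_c ≤ m (bmt)^{p+1}/(1 − bmt)·w_c`. If row `c` of the field has its own bilinear constant,
`|Q(u,v)_c| ≤ b_c·N_u·N_v·w_c`, one more step of the Cauchy-majorant induction gives the ROW form (`taylorJet_row_bound`:
`|T_{k+1}(y)_c| ≤ b_c m² (bm)^k w_c`; `taylor_remainder_row`: `|ψ(t) − TP_t(y)|_c ≤ b_c · m² t (bmt)^p/(1 − bmt) · w_c`, i.e. the uniform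
remainder times `β_c = b_c/b`). `lohner_land_mvr` is glue XVIII-c `lohner_land_mv` with this remainder in the per-component E-recursion:
`dP_c + κ_c + NVE_c + b_c·m'² h (b m' h)^p/(1 − b m' h)·w_c ≤ E'_c`.

HONEST FRAMING: abstract finite-dimensional ODE analysis (Taylor models with remainder); nothing about any particular table, no stub closed,
nothing about the Navier–Stokes equations.
-/

noncomputable section

-- the sub-problem namespace repeats the summit name by design (D-0017)
set_option linter.dupNamespace false

namespace Summit.NavierStokesRegularity.NavierStokesRegularity.Theorems

open Set Finset Summit.NavierStokesRegularity.NavierStokesRegularity.Theorems.TaylorModelReadout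
open Summit.NavierStokesRegularity.NavierStokesRegularity.Theorems.TaylorModelMajorant

namespace CertificateGlueOn

variable {n : ℕ} {Q : (Fin n → ℝ) → (Fin n → ℝ) → Fin n → ℝ} {w : Fin n → ℝ} {b : ℝ}

/-- **Per-row Cauchy majorant of the Taylor jets**: with row constants `b_c` (`|Q(u,v)_c| ≤ b_c N_u N_v w_c`) on top of the uniform bound `b`,
`|T_{k+1}(x)_c| ≤ b_c · m² (bm)^k · w_c` for `|x| ≤ m·w`. [folklore] -/
theorem taylorJet_row_bound (h : IsMajorantSystem n Q w b (taylorJet Q) (varJet Q)) {brow : Fin n → ℝ}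
    (hBrow : ∀ (u v : Fin n → ℝ) (Nu Nv : ℝ), 0 ≤ Nu → 0 ≤ Nv → (∀ c, |u c| ≤ Nu * w c) → (∀ c, |v c| ≤ Nv * w c) →
      ∀ c, |Q u v c| ≤ brow c * Nu * Nv * w c)
    {x : Fin n → ℝ} {m : ℝ} (hx : ∀ c, |x c| ≤ m * w c) (k : ℕ) (c : Fin n) :
    |taylorJet Q x (k + 1) c| ≤ brow c * m ^ 2 * (b * m) ^ k * w c := by
  have hm : 0 ≤ m := h.nonneg_of_wbound c (hx c)
  have hbm : 0 ≤ b * m := mul_nonneg h.b_nonneg hm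
  have hT := h.T_bound hx
  refine abs_le_of_mul_eq_sum (h.T_succ x k c) (g := fun _ => brow c * m ^ 2 * (b * m) ^ k * w c) ?_ ?_
  · intro i hi
    obtain ⟨j, rfl⟩ := Nat.exists_eq_add_of_le (Nat.lt_succ_iff.mp (mem_range.mp hi))
    rw [Nat.add_sub_cancel_left]
    calc |Q (taylorJet Q x i) (taylorJet Q x j) c|
        ≤ brow c * (m * (b * m) ^ i) * (m * (b * m) ^ j) * w c :=
          hBrow _ _ _ _ (by positivity) (by positivity) (hT i) (hT j) c
      _ = brow c * m ^ 2 * (b * m) ^ (i + j) * w c := by rw [pow_add]; ring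
  · rw [sum_const, card_range, nsmul_eq_mul]
    push_cast
    exact le_rfl

/-- **THE PER-ROW TAYLOR REMAINDER OF THE FLOW**: for a solution `ψ` of `ψ' = Q(ψ,ψ)` on `[0,t]` from `y`, `|y| ≤ m·w`, `b m t < 1`,
`|ψ(t)_c − TP_t(y)_c| ≤ b_c · m² t (bmt)^p/(1 − bmt) · w_c` (`= (b_c/b)` × the uniform remainder of S1). [cite: BerzMakino1998, §2–3 (verified integration of ODE flows by Taylor models: remainder by the majorant series)] -/
theorem taylor_remainder_row (hQl : ∀ u, IsLinearMap ℝ (Q u)) (hQr : ∀ v, IsLinearMap ℝ (fun u => Q u v))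
    (hw : ∀ c, 0 < w c) (hb : 0 ≤ b)
    (hB : ∀ (u v : Fin n → ℝ) (Nu Nv : ℝ), 0 ≤ Nu → 0 ≤ Nv → (∀ c, |u c| ≤ Nu * w c) →
      (∀ c, |v c| ≤ Nv * w c) → ∀ c, |Q u v c| ≤ b * Nu * Nv * w c)
    {brow : Fin n → ℝ}
    (hBrow : ∀ (u v : Fin n → ℝ) (Nu Nv : ℝ), 0 ≤ Nu → 0 ≤ Nv → (∀ c, |u c| ≤ Nu * w c) → (∀ c, |v c| ≤ Nv * w c) →
      ∀ c, |Q u v c| ≤ brow c * Nu * Nv * w c)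
    {y : Fin n → ℝ} {m t : ℝ} (hm : 0 ≤ m) (hy : ∀ c, |y c| ≤ m * w c) (ht : 0 ≤ t) (hq : b * m * t < 1)
    {ψ : ℝ → Fin n → ℝ} (hψ0 : ψ 0 = y) (hψd : ∀ s ∈ Icc 0 t, HasDerivWithinAt ψ (Q (ψ s) (ψ s)) (Icc 0 t) s)
    (p : ℕ) (c : Fin n) :
    |ψ t c - TPoly Q p y t c| ≤ brow c * (m ^ 2 * t * (b * m * t) ^ p / (1 - b * m * t)) * w c := by
  have h : IsMajorantSystem n Q w b (taylorJet Q) (varJet Q) :=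
    ⟨hw, hb, hQl, hQr, hB, taylorJet_zero Q, taylorJet_succ_apply Q, varJet_zero Q, varJet_succ_apply Q⟩
  have htI : t ∈ Icc 0 t := ⟨ht, le_rfl⟩
  -- the solution is the Taylor series
  have hψ : ψ t = pseries (taylorJet Q y) t := by
    rw [← h.flowSel_eq ⟨hψ0, hψd⟩ htI, h.flowSel_eq_pseries hm hy ht hq htI]
  have hsum := h.summable_T hy ht hq c
  have split : pseries (taylorJet Q y) t c - TPoly Q p y t c = ∑' k, taylorJet Q y (k + (p + 1)) c * t ^ (k + (p + 1)) := by
    simp only [pseries, TPoly]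
    rw [← hsum.sum_add_tsum_nat_add (p + 1), add_sub_cancel_left]
  rw [hψ, split]
  -- the row majorant of the tail
  have hq0 : 0 ≤ b * m * t := by positivity
  have hgeom := (hasSum_geom hq0 hq).mul_left (brow c * (m ^ 2 * t * (b * m * t) ^ p) * w c)
  have hTl : HasSum (fun k : ℕ => brow c * m ^ 2 * (b * m) ^ (k + p) * w c * t ^ (k + (p + 1)))
      (brow c * (m ^ 2 * t * (b * m * t) ^ p / (1 - b * m * t)) * w c) := by
    refine hasSum_of_eq hgeom (fun k => ?_) ?_
    · rw [pow_add, pow_add, mul_pow, mul_pow]; ring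
    · rw [div_eq_mul_inv]; ring
  have key := tsum_of_norm_bounded hTl (f := fun k => taylorJet Q y (k + (p + 1)) c * t ^ (k + (p + 1))) fun k => by
    rw [Real.norm_eq_abs, abs_mul, abs_of_nonneg (pow_nonneg ht _), show k + (p + 1) = (k + p) + 1 by ring]
    exact mul_le_mul_of_nonneg_right (taylorJet_row_bound h hBrow hy (k + p) c) (pow_nonneg ht _)
  simpa only [Real.norm_eq_abs] using key

/-- **THE MEAN-VALUE LOHNER LANDING WITH A REMAINDER VECTOR AND PER-ROW REMAINDER FACTORS** (glue XVIII-c `lohner_land_mv` with the Taylor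
remainder from the node point taken per row: `b_c · m'² h (b m' h)^p/(1 − b m' h) · w_c`). [cite: Zgliczynski2002C1Lohner, §3–4 (Lohner-type parallelepiped frames: mean-value form of the C¹ enclosure)] -/
theorem lohner_land_mvr (hQl : ∀ u, IsLinearMap ℝ (Q u)) (hQr : ∀ v, IsLinearMap ℝ (fun u => Q u v))
    {w : Fin n → ℝ} (hw : ∀ c, 0 < w c) (hb : 0 ≤ b)
    (hB : ∀ (u v : Fin n → ℝ) (Nu Nv : ℝ), 0 ≤ Nu → 0 ≤ Nv → (∀ c, |u c| ≤ Nu * w c) →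
      (∀ c, |v c| ≤ Nv * w c) → ∀ c, |Q u v c| ≤ b * Nu * Nv * w c)
    {brow : Fin n → ℝ}
    (hBrow : ∀ (u v : Fin n → ℝ) (Nu Nv : ℝ), 0 ≤ Nu → 0 ≤ Nv → (∀ c, |u c| ≤ Nu * w c) → (∀ c, |v c| ≤ Nv * w c) →
      ∀ c, |Q u v c| ≤ brow c * Nu * Nv * w c)
    {p : ℕ} {h m' : ℝ} {x x' : Fin n → ℝ} {C Cn T : Matrix (Fin n) (Fin n) ℝ}
    {r r' ρ E E₁ dP κ NVE : Fin n → ℝ} (hh : 0 ≤ h) (hm' : 0 ≤ m')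
    (hnode : ∀ ξ e : Fin n → ℝ, (∀ c, |ξ c| ≤ r c) → (∀ c, |e c| ≤ E c) →
      ∀ c, |(x + (C.mulVec ξ + e)) c| ≤ m' * w c)
    (hguard : b * m' * h < 1)
    (hC : ∀ ξ : Fin n → ℝ, (∀ c, |ξ c| ≤ r c) → ∀ c, |C.mulVec ξ c| ≤ ρ c)
    (hdP : ∀ c, |TPoly Q p x h c - x' c| ≤ dP c)
    (hκ : ∀ z : Fin n → ℝ, (∀ d, |z d - x d| ≤ ρ d + E d) → ∀ ξ : Fin n → ℝ, (∀ c, |ξ c| ≤ r c) →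
      ∀ c, |(VPoly Q p z (C.mulVec ξ) h - Cn.mulVec (T.mulVec ξ)) c| ≤ κ c)
    (hNVE : ∀ z : Fin n → ℝ, (∀ d, |z d - x d| ≤ ρ d + E d) → ∀ e : Fin n → ℝ, (∀ c, |e c| ≤ E c) →
      ∀ c, |VPoly Q p z e h c| ≤ NVE c)
    (hframe : ∀ ξ : Fin n → ℝ, (∀ c, |ξ c| ≤ r c) → ∀ c, |T.mulVec ξ c| ≤ r' c)
    (hE₁ : ∀ c, dP c + κ c + NVE c + brow c * (m' ^ 2 * h * (b * m' * h) ^ p / (1 - b * m' * h)) * w c ≤ E₁ c) :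
    ∀ (ξ e : Fin n → ℝ), (∀ c, |ξ c| ≤ r c) → (∀ c, |e c| ≤ E c) →
      ∀ ψ : ℝ → Fin n → ℝ, ψ 0 = x + (C.mulVec ξ + e) →
        (∀ s ∈ Icc 0 h, HasDerivWithinAt ψ (Q (ψ s) (ψ s)) (Icc 0 h) s) →
          ∃ ξ' e' : Fin n → ℝ, (∀ c, |ξ' c| ≤ r' c) ∧ (∀ c, |e' c| ≤ E₁ c) ∧ ψ h = x' + (Cn.mulVec ξ' + e') := by
  intro ξ e hξ he ψ hψ0 hψd
  set v := C.mulVec ξ + e with hvdef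
  set y := x + v with hydef
  -- the per-row Taylor remainder from the node point
  have hyw : ∀ c, |y c| ≤ m' * w c := hnode ξ e hξ he
  have hR : ∀ c, |ψ h c - TPoly Q p y h c| ≤ brow c * (m' ^ 2 * h * (b * m' * h) ^ p / (1 - b * m' * h)) * w c :=
    fun c => taylor_remainder_row hQl hQr hw hb hB hBrow hm' hyw hh hguard hψ0 hψd p c
  -- the hull box contains the segment from the centre to the node point
  have hv : ∀ d, |v d| ≤ ρ d + E d := fun d => by
    simp only [hvdef, Pi.add_apply]
    exact (abs_add_le _ _).trans (add_le_add (hC ξ hξ d) (he d))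
  have hz : ∀ θ ∈ Icc (0 : ℝ) 1, ∀ d, |(x + θ • v) d - x d| ≤ ρ d + E d := by
    intro θ hθ d
    simp only [Pi.add_apply, Pi.smul_apply, smul_eq_mul, add_sub_cancel_left, abs_mul, abs_of_nonneg hθ.1]
    exact (mul_le_of_le_one_left (abs_nonneg _) hθ.2).trans (hv d)
  -- the new coordinates and the remainder vector
  set ξ' := T.mulVec ξ with hξ'
  refine ⟨ξ', ψ h - x' - Cn.mulVec ξ', hframe ξ hξ, fun c => ?_, by abel⟩
  obtain ⟨θ, hθ, hmv⟩ := exists_TPoly_sub_eq_VPoly hQl hQr p x v h c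
  set z := x + θ • v with hzdef
  have hsplit : VPoly Q p z v h c = VPoly Q p z (C.mulVec ξ) h c + VPoly Q p z e h c := by
    have := congrFun (VPoly_add hQl hQr p z (C.mulVec ξ) e h) c
    simpa [hvdef] using this
  have e1 : (ψ h - x' - Cn.mulVec ξ') c =
      (ψ h c - TPoly Q p y h c) + (TPoly Q p x h c - x' c) +
        (VPoly Q p z (C.mulVec ξ) h - Cn.mulVec (T.mulVec ξ)) c + VPoly Q p z e h c := by
    have hy' : TPoly Q p y h c = TPoly Q p x h c + VPoly Q p z v h c := by rw [hydef]; linarith [hmv]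
    simp only [Pi.sub_apply, hy', hsplit, hξ']
    ring
  rw [e1]
  have h1 := hR c
  have h2 := hdP c
  have h3 := hκ z (hz θ hθ) ξ hξ c
  have h4 := hNVE z (hz θ hθ) e he c
  calc |(ψ h c - TPoly Q p y h c) + (TPoly Q p x h c - x' c) +
        (VPoly Q p z (C.mulVec ξ) h - Cn.mulVec (T.mulVec ξ)) c + VPoly Q p z e h c|
      ≤ |ψ h c - TPoly Q p y h c| + |TPoly Q p x h c - x' c| +
        |(VPoly Q p z (C.mulVec ξ) h - Cn.mulVec (T.mulVec ξ)) c| + |VPoly Q p z e h c| := by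
          refine (abs_add_le _ _).trans (add_le_add ((abs_add_le _ _).trans (add_le_add (abs_add_le _ _) le_rfl))
            le_rfl)
    _ ≤ E₁ c := by linarith [hE₁ c]

end CertificateGlueOn

end Summit.NavierStokesRegularity.NavierStokesRegularity.Theorems

end
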